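import Summits.CriticalPhenomena.PercolationContinuityZ3.Theorems.PercNearOneGluingNoHeavyLowerTailSahiGridPatternHarris

/-!
# `NoHeavyLowerTail` (crux stmt-CriticalPhenomena-4575), Sahi programme P1: the DIAGONAL of the pattern functional is trivially
# nonnegative — for ARBITRARY sets, by exchangeability of the Latin triple

Support file (Sahi cell, seat `prim-sahi-p1`, generation 17; `--supports stmt-CriticalPhenomena-4575`).  Pure proofs, no definitions, no `sorry`,
standard axioms.  Vocabulary of `…SahiGridPattern` (`Pd`, `col`, `sStarD`), `…SahiGridThreeKernel` (`ind`, `hZ`), `…SahiGridPatternHarris` (`ind_eq_zero_or_one`).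

* `sum_col_relabel` — the sum over the `6^d` permutation patterns is invariant under relabelling the three copies by a fixed `σ ∈ S₃`
  (the Latin triple `(col π 0, col π 1, col π 2)` is EXCHANGEABLE).
* `sum_perm_hZ_self` — on the diagonal `A = B = C` the kernel averaged over the six relabellings of one pattern is
  `4·Σᵢ aᵢ − 6·Σ_{i<j} aᵢaⱼ + 6·a₀a₁a₂ = 6·[some copy lies in A] − 2·#{copies in A} ≥ 0` (`aᵢ = 1_A(pᵢ)`).
* `six_mul_sStarD_self_eq`, **`sStarD_self_nonneg`** — hence for EVERY finset `A ⊆ [3]^d` (no monotonicity hypothesis)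
  `6 · sStarD A A A = Σ_π Σ_σ h ≥ 0`, i.e. `sStarD A A A = #{ordered Latin triples meeting A} − 2^d·#A ≥ 0`
  (inclusion–exclusion `P(E₁ ∪ E₂ ∪ E₃) = 3P(E₁) − 3P(E₁E₂) + P(E₁E₂E₃)` against `E₃ = 2P(E₁) − 3P(E₁E₂) + P(E₁E₂E₃)` on the diagonal).
So the diagonal of `PatternPos d` carries no information about monotonicity.  Recorded with the generation-17 no-go theorems for
dimension-uniform LINEAR proofs of `PatternPos` (memo `run/shared/lean/prim/prim-sahi/FROM-prim-sahi-p1-gen17-NO-LINEAR-INDUCTION.md` §0(VI)).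
[this work]
-/

namespace Summit.CriticalPhenomena.PercolationContinuityZ3.Theorems.SahiGridPattern

open Finset SahiGrid3
open scoped BigOperators

variable {d : ℕ}

/-- Relabelling the copies: `col (a ↦ π a * σ) c = col π (σ c)`. [this work] -/
theorem col_mul_right (π : Fin d → Equiv.Perm (Fin 3)) (σ : Equiv.Perm (Fin 3)) (c : Fin 3) :
    col (fun a => π a * σ) c = col π (σ c) := by
  funext a
  rfl

/-- **Exchangeability of the Latin triple**: the pattern sum of any kernel is invariant under a fixed relabelling `σ ∈ S₃` of the
three copies. [this work] -/
theorem sum_col_relabel (σ : Equiv.Perm (Fin 3)) (F : Pd d → Pd d → Pd d → ℤ) :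
    ∑ π : Fin d → Equiv.Perm (Fin 3), F (col π (σ 0)) (col π (σ 1)) (col π (σ 2)) =
      ∑ π : Fin d → Equiv.Perm (Fin 3), F (col π 0) (col π 1) (col π 2) := by
  refine Fintype.sum_equiv (Equiv.piCongrRight fun _ : Fin d => Equiv.mulRight σ) _ _ fun π => ?_
  show F (col π (σ 0)) (col π (σ 1)) (col π (σ 2)) = F (col (fun a => π a * σ) 0) (col (fun a => π a * σ) 1) (col (fun a => π a * σ) 2)
  rw [col_mul_right, col_mul_right, col_mul_right]

/-- The diagonal kernel summed over the six relabellings of one pattern: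
`Σ_σ h(p_{σ0},p_{σ1},p_{σ2}) = 4·Σᵢ aᵢ − 6·Σ_{i<j} aᵢaⱼ + 6·a₀a₁a₂` (`= 6·[some pᵢ ∈ A] − 2·#{i : pᵢ ∈ A}`), `aᵢ = 1_A(pᵢ)`. [this work] -/
theorem sum_perm_hZ_self (A : Finset (Pd d)) (p : Fin 3 → Pd d) :
    ∑ σ : Equiv.Perm (Fin 3), hZ A A A (p (σ 0)) (p (σ 1)) (p (σ 2)) =
      4 * (ind A (p 0) + ind A (p 1) + ind A (p 2))
        - 6 * (ind A (p 0) * ind A (p 1) + ind A (p 0) * ind A (p 2) + ind A (p 1) * ind A (p 2))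
        + 6 * (ind A (p 0) * ind A (p 1) * ind A (p 2)) := by
  have e010 : Equiv.swap (0 : Fin 3) 1 0 = 1 := by decide
  have e011 : Equiv.swap (0 : Fin 3) 1 1 = 0 := by decide
  have e012 : Equiv.swap (0 : Fin 3) 1 2 = 2 := by decide
  have e020 : Equiv.swap (0 : Fin 3) 2 0 = 2 := by decide
  have e021 : Equiv.swap (0 : Fin 3) 2 1 = 1 := by decide
  have e022 : Equiv.swap (0 : Fin 3) 2 2 = 0 := by decide
  have e120 : Equiv.swap (1 : Fin 3) 2 0 = 0 := by decide
  have e121 : Equiv.swap (1 : Fin 3) 2 1 = 2 := by decide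
  have e122 : Equiv.swap (1 : Fin 3) 2 2 = 1 := by decide
  rw [sum_perm_eq_permList]
  simp only [permList, List.map_cons, List.map_nil, List.sum_cons, List.sum_nil, hZ, Equiv.Perm.one_apply, Equiv.trans_apply,
    e010, e011, e012, e020, e021, e022, e120, e121, e122]
  rcases ind_eq_zero_or_one A (p 0) with h0 | h0 <;> rcases ind_eq_zero_or_one A (p 1) with h1 | h1 <;>
    rcases ind_eq_zero_or_one A (p 2) with h2 | h2 <;> rw [h0, h1, h2] <;> norm_num

/-- Pointwise nonnegativity of the relabelling sum on the diagonal: `6·[∃ copy in A] ≥ 2·#{copies in A}`. [this work] -/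
theorem sum_perm_hZ_self_nonneg (A : Finset (Pd d)) (p : Fin 3 → Pd d) :
    0 ≤ ∑ σ : Equiv.Perm (Fin 3), hZ A A A (p (σ 0)) (p (σ 1)) (p (σ 2)) := by
  rw [sum_perm_hZ_self]
  rcases ind_eq_zero_or_one A (p 0) with h0 | h0 <;> rcases ind_eq_zero_or_one A (p 1) with h1 | h1 <;>
    rcases ind_eq_zero_or_one A (p 2) with h2 | h2 <;> rw [h0, h1, h2] <;> norm_num

/-- **`6 · sStarD A A A = Σ_π Σ_σ h`** (average the diagonal kernel over the six relabellings of the copies). [this work] -/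
theorem six_mul_sStarD_self_eq (A : Finset (Pd d)) :
    6 * sStarD A A A = ∑ π : Fin d → Equiv.Perm (Fin 3), ∑ σ : Equiv.Perm (Fin 3), hZ A A A (col π (σ 0)) (col π (σ 1)) (col π (σ 2)) := by
  rw [Finset.sum_comm]
  have h : ∀ σ : Equiv.Perm (Fin 3),
      ∑ π : Fin d → Equiv.Perm (Fin 3), hZ A A A (col π (σ 0)) (col π (σ 1)) (col π (σ 2)) = sStarD A A A := fun σ => by
    unfold sStarD; exact sum_col_relabel σ (hZ A A A)
  rw [Finset.sum_congr rfl fun σ _ => h σ, Finset.sum_const, Finset.card_univ, Fintype.card_perm, Fintype.card_fin]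
  norm_num

/-- **The diagonal of the pattern functional is nonnegative for EVERY finset** `A ⊆ [3]^d` (no up-set hypothesis):
`sStarD A A A = #{ordered Latin triples meeting A} − 2^d·#A ≥ 0`. [this work] -/
theorem sStarD_self_nonneg (A : Finset (Pd d)) : 0 ≤ sStarD A A A := by
  have h6 : 0 ≤ 6 * sStarD A A A := by
    rw [six_mul_sStarD_self_eq]
    exact Finset.sum_nonneg fun π _ => sum_perm_hZ_self_nonneg A (col π)
  omega

end Summit.CriticalPhenomena.PercolationContinuityZ3.Theorems.SahiGridPattern
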